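import Mathlib
import HarnessLib
import Literature.Analysis.FluidPDE.DirectionDissipation
import Summits.NavierStokesRegularity.NavierStokesRegularity.Theses.LocalSineTubeDoor
import Summits.NavierStokesRegularity.NavierStokesRegularity.Theorems.LocalSineTubeDoorLocalPointZoomFrame
import Summits.NavierStokesRegularity.NavierStokesRegularity.Theorems.LocalSineTubeDoorLocalPointZoomCurl

/-!
# Route `LocalSineTubeDoor`, crux `LocalPointZoom` (stmt-NavierStokesRegularity-20017) — PROVED

Cell ns-regularity-ideate, seat p6 (`--supports stmt-NavierStokesRegularity-20017`; the type of
`localPointZoom_proof` is LITERALLY the route decl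
`Summit.NavierStokesRegularity.NavierStokesRegularity.Theses.LocalSineTubeDoor.LocalPointZoom`).

LOCAL POINT ZOOM LIMIT.  For a classical NS solution on `[0,T)` (Leray–Hopf, rapidly decaying datum) that is
locally Type I at `(x₀,T)` — `‖u(t,x)‖ √(ν(T−t)) ≤ M` on the one parabolic cylinder `B(x₀,ρ) × ((T−ρ²)∨0, T)` —
but NOT backward bounded at `(x₀,T)`, there are `C`, a profile `v` and scales `λⱼ → 0⁺` such that `v` has the
Type-I time rate, is continuous on `(−∞,0) × ℝ³`, satisfies the unit-viscosity Oseen–Duhamel identity between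
any two negative times, is divergence-free, is backward-singular at the apex, and for every `y` the rescaled
vorticities `(λⱼ²/ν) ω(T − λⱼ²/ν, x₀ + λⱼ y)` converge to `curl v(−1, y)`.

Assembly of the support files `LocalSineTubeDoorLocalPointZoom{Zoom,Rate,Frame,Upgrade,Data,Curl}.lean` — the
LOCAL version of the cell's kernel theorem `Cell.NsRegP1c.pointZoomLimit_holds` (global Type I): the local
Type-I hypothesis enters (a) the zoom (A–B 2019 Lemma 2.5 / Remark 3.2 replaces the Morrey bound + Lemma 2.6),
(b) the rate of the zoom (a ball `‖y‖ < ρ/R` suffices since the zoom-in exhausts `ℝ³`), (c) the sup bound on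
the unit cylinders feeding Seregin–Šverák's interior estimates (two extra thresholds in `j`).  The scales of
the statement are `λⱼ = R·λⱼ^{Seregin}/2`.

Sources: Albritton–Barker 2019 (arXiv:1811.00502) Thm 1.1 / §3, Lemma 2.5, Prop. 2.3; Seregin 2014 Prop. 6.20;
Seregin–Šverák 2009 §2; KNSS 2009.  WHAT THIS IS NOT: not a claim about Navier–Stokes regularity — it closes
the support cone of the rank-2 crux of a DRAFT rung-leaf route (door N0-`LocalTubeDoorSine`).
-/

noncomputable section

namespace Summit.NavierStokesRegularity.NavierStokesRegularity.Theorems.LocalSineTubeDoorLocalPointZoom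

open MeasureTheory Set Function Filter Topology TopologicalSpace Metric
open Literature.Analysis Literature.Analysis.FluidPDE
open Summit.NavierStokesRegularity.NavierStokesRegularity.Theorems
open Summit.NavierStokesRegularity.NavierStokesRegularity.Theorems.LocalSineTubeDoorLocalPointZoomFrame
open Summit.NavierStokesRegularity.NavierStokesRegularity.Theorems.LocalSineTubeDoorLocalPointZoomCurl
open scoped NNReal ENNReal

/-- **The route's crux `LocalPointZoom` (stmt-NavierStokesRegularity-20017) is a THEOREM**: the local tree
zoom frame at the non-backward-bounded, locally Type I point (`localTreeZoomFrame`) + the local interior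
vorticity upgrade (`localZoomFrame_curl_tendsto`, no subsequence), with scales `R·λⱼ/2`. -/
theorem localPointZoom_proof :
    Summit.NavierStokesRegularity.NavierStokesRegularity.Theses.LocalSineTubeDoor.LocalPointZoom := by
  intro ν T hν hT u p hsol hLH _ x₀ ρ M hρ hM hnotbd
  obtain ⟨R, C₁, v', π', lam, w, v₁, Ks, r₁, hR, hlam, hlam0, hball1, hr₁, hr₁1, hKs, hL3, hae, hP,
    hsing₁, hpt⟩ := localTreeZoomFrame hν hT hsol hLH hρ hM hnotbd
  refine ⟨C₁, v₁, fun j => R * (lam j / 2), fun j => mul_pos hR (half_pos (hlam j)),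
    by simpa using (hlam0.div_const 2).const_mul R, hP, hsing₁, fun y => ?_⟩
  have hcurlZ : ∀ j, curl (((lam j) • stPull ((lam j) ^ 2) (lam j) (0 : ℝ)
      (0 : EuclideanSpace ℝ (Fin 3)) v') (-1)) y =
      ((R * (lam j / 2)) ^ 2 / ν) • curl (u (T - (R * (lam j / 2)) ^ 2 / ν))
        (x₀ + (R * (lam j / 2)) • y) := by
    intro j
    have hfun : ((lam j) • stPull ((lam j) ^ 2) (lam j) (0 : ℝ) (0 : EuclideanSpace ℝ (Fin 3)) v') (-1) =
        (((R * (lam j / 2)) / ν) • stPull ((R * (lam j / 2)) ^ 2 / ν) (R * (lam j / 2)) T x₀ u)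
          (-1) := by
      funext y'
      rw [hpt j (-1) y', smul_stPull_apply]
      congr 2
      ring
    rw [hfun, curl_smul_stPull]
    congr 1
    · field_simp
    · congr 2
      ring
  refine (tendsto_congr hcurlZ).1 ?_
  exact localZoomFrame_curl_tendsto hν hT hsol.smooth_velocity.continuousOn hρ hM hR hball1 hlam hlam0
    hr₁ hr₁1 hKs hpt hL3 hae hP.1 hP.2.1 hP.2.2.1 y

end Summit.NavierStokesRegularity.NavierStokesRegularity.Theorems.LocalSineTubeDoorLocalPointZoom

end
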